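import Summits.BirchSwinnertonDyer.Rank1Residual.ManinAdditive.NeronConway
import Summits.BirchSwinnertonDyer.Rank1Residual.ManinAdditive.ConwayKodairaLaws
import Summits.BirchSwinnertonDyer.Rank1Residual.ManinAdditive.ConwayRamanujanCutEdges
import HarnessLib
import HarnessLib.Audit.Tags

/-!
# The END-SATURATED Conway lattice `S^{G,R}` (`R₄` at `16 ∣ N`, `R₈` at `64 ∣ N`), law E-imc-131 `StarredEndSaturatedDefectLaw`,
# the R-saturated GIVEN row E-imc-132 `IsEndSaturatedConwayNeronAtTwo` and the decidable instance E-imc-133 `EndSaturationBitesAt272`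
# (imc g18, MEMO-imc §24.9–24.14) — cell `bsd-f2-manin` (D-0131 (3) frontier: the Manin constant at additive primes); sibling of
# `NeronConway` / `ConwayCut` / `ConwayKodairaLaws`

HONEST FRAMING.  LENS = Iwasawa-main-conjecture / integrality of `q`-expansions at additive level (planner `bsd-f2-manin-imc`
g18, planner-of-record; HOME `run/shared/lean/pub/bsd-f2-manin/MEMO-imc.md` §24.9–24.14; evidence #55/#56 on
stmt-BirchSwinnertonDyer-22967).  Source: HOME/imc/Sketch-imc-g18b.lean sha16 **0e966af5982be4b5** (143 l., «v2: JOINT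
saturation», farm rc 0 per imc; imc's INBOX line 2026-08-28T16:07:10Z cites the v1 sha 47bff5dc10521433 — the HOME copy at
filing time is v2 and is what is copied), VERBATIM (namespace `…ManinAdditive.NeronConwayR` kept) with exactly these deviations,
all recorded at the declaration: (i) `@[conjecture]` on E-imc-131 and E-imc-133 (closed `Prop`s; nothing asserted — E-imc-133 is
a DECIDABLE instance by exact linear algebra per imc's two engine runs, not kernel-checked here); E-imc-132
`IsEndSaturatedConwayNeronAtTwo Δ` is a GIVEN-datum PREDICATE (like desc's `IsConwayNeronAtTwo Δ`), untagged; (ii) `[cite: …]`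
tags in the tree's «shape only … NOT in print» format; (iii) the sketch's two lemmas `conwayStableLattice_map_atkinLehner_le` /
`conwayStableLattice_map_halfTranslate_le` are NOT re-declared: they are refuter-1's RB61.1, already in the tree
(`ConwayRamanujanCutEdges`, imported) and are used BY NAME; (iv) `import HarnessLib.Audit.Tags`.  Filed at imc's request
T-imc-19 (HOME/INBOX.md 2026-08-28T16:07:10Z) by the cell typer (g13).  REFUTER VERDICTS AT FILING: REF1 R-imc-50 (statement
audit E-imc-131/132/133 + «`R₄, R₈ ∈ End_ℚ J₀(N)` ⟹ `Λ` stable») PENDING; REF2 placement of `S^{G,R}` / the tower-count law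
(imc's corpus + galaxy searches null, MEMO §24.10) PENDING.  A finding is repaired under a NEW name in this file (append-only).
bears_on: stmt-BirchSwinnertonDyer-22967 (C2 `ManinOddAtFour`: at `v₂(N) ≥ 4` the honest E-blind bound is `σ₂^R`, and the GIVEN
row must be R-saturated — `IsConwayNeronAtTwo` is FALSE at `N = 240`, `NeronConway.not_isConwayNeronAtTwo_of_notRamanujanStable`).
Beyond-print theorem: no (the FACT `Λ ⊆ S^{G,R}` is one line from the Néron mapping property; the laws are census laws).
BSD is not proved by this; Manin's conjecture is not proved by this; C2 is not closed by this.

IMC g18b TEXT (VERBATIM):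
# Sketch-imc-g18b (v2: JOINT saturation) — the END-SATURATED Conway lattice `S^{G,R}` and law E-imc-131 (imc g18, MEMO-imc §24.11–24.14)

`S^{G,R}(N)` := the largest sublattice of desc's Conway lattice `S^G(N) = conwayStableLattice N` stable under
`R₄ = t_{1/4} + t_{3/4}` (meaningful at `16 ∣ N`) and `R₈ = Σ_{j odd} t_{j/8}` (at `64 ∣ N`).  Both are in
`End_ℚ J₀(N)` (Galois-invariant sums of automorphisms of `X₀(N)` over `ℚ(ζ₈)`), so the Néron lattice satisfies
`Λ ⊆ S^{G,R} ⊆ S^G` (Néron mapping property) and `σ₂^R := ord₂ deg φ − ord₂ [e_f S^{G,R} : ℤf]` is a certified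
lower bound for `ord₂ c_E + k₂`, sharper than desc's `σ₂` at `v₂(N) ≥ 4` (equal at `v₂(N) ≤ 3`).
ENGINE 6 v6 (HOME/imc/kit-g18/neronconway6.gp 1abda151dd876930, kit j311860; 16 ∣ N ≤ 520, 134 optimal classes):
`σ₂^R > σ₂` on exactly 272c1, 416a1, 464d1, 464f1 (all I₀*, `0 → 1`); starred ∧ no rational 2-torsion ⟹ `σ₂^R = 1`
38/38 (plain 35/38); unstarred ⟹ `σ₂^R = 0` 57/57.  Nothing here is asserted.
-/

open scoped MatrixGroups ModularForm
open CongruenceSubgroup WeierstrassCurve Literature.NumberTheory.EllipticCurves.ModularForms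
open Summit.BirchSwinnertonDyer.Rank1Residual.ManinAdditive
open Summit.BirchSwinnertonDyer.Rank1Residual.ManinAdditive.ConwayCut
open Summit.BirchSwinnertonDyer.Rank1Residual.ManinAdditive.NeronConway

noncomputable section

namespace Summit.BirchSwinnertonDyer.Rank1Residual.ManinAdditive.NeronConwayR

/-- The upper-triangular matrix `⟨8, j; 0, 8⟩ ∈ GL₂(ℚ)⁺` (slash action `τ ↦ τ + j/8`). -/
def eighthTranslateGL (j : ℕ) : GL(2, ℚ)⁺ :=
  ⟨Matrix.GeneralLinearGroup.mkOfDetNeZero !![8, (j : ℚ); 0, 8] (by simp [Matrix.det_fin_two]),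
    by simp [Matrix.det_fin_two]⟩

/-- `R₈ := Σ_{j ∈ (ℤ/8)ˣ} t_{j/8}` on `S_k(Γ₀(N))` (an endomorphism of `J₀(N)` over `ℚ` when `64 ∣ N`), normalised like
`NeronConway.ramanujanFour` so that it acts on `q`-expansions by `a_n ↦ c₈(n) a_n`, `c₈` the Ramanujan sum
(`4` if `8 ∣ n`, `−4` if `n ≡ 4 (mod 8)`, `0` otherwise).  Junk if `64 ∤ N`. (imc g18b VERBATIM.)
[cite: AtkinLehner1970, §4 (shape only: the translations `z ↦ z + j/8` lie in the normaliser of `Γ₀(N)` for `64 ∣ N`; the Galois-symmetrised sum `R₈` as a `ℚ`-endomorphism of `J₀(N)` is folklore, Conway–Norton)] -/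
def ramanujanEight (N : ℕ) [NeZero N] (k : ℤ) : CuspForm (Gamma0 N) k →ₗ[ℂ] CuspForm (Gamma0 N) k :=
  (((64 : ℝ) ^ (1 - (k : ℝ) / 2) : ℝ) : ℂ) •
    (cuspHeckeOperatorₗ (Gamma0 N) k (eighthTranslateGL 1) + cuspHeckeOperatorₗ (Gamma0 N) k (eighthTranslateGL 3) +
      cuspHeckeOperatorₗ (Gamma0 N) k (eighthTranslateGL 5) + cuspHeckeOperatorₗ (Gamma0 N) k (eighthTranslateGL 7))

variable (N : ℕ) [NeZero N] in
/-- **The End-saturated Conway lattice `S^{G,R}(N)`** (v2, JOINT saturation): the largest `ℤ`-submodule of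
`S₂(Γ₀(N); ℤ)` stable under every Atkin–Lehner involution `w_{Q_p}`, the half-translation `t`, AND `R₄` when `16 ∣ N`,
`R₈` when `64 ∣ N` — i.e. desc's `conwayStableLattice` with the two normaliser-sum endomorphisms added to the generating
set (the `sSup` of all such submodules is again one).  It is contained in `conwayStableLattice N`, equal to it at
`16 ∤ N`, and contains the Néron lattice (all generators lie in `End_ℚ J₀(N)` ∪ `Aut`).  ENGINE 6 v8 (kit j312138): the
joint saturation is STRICTLY smaller than «largest `R`-stable sublattice of `S^G`» at `N = 352, 480` (the latter is not
`w`-stable there: `w R₄ w⁻¹ = Tr_{N/4} − Tr_{N/2} ≠ R₄`). (imc g18b VERBATIM.) [folklore] -/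
def endSaturatedConwayLattice : Submodule ℤ (CuspForm (Gamma0 N) 2) :=
  sSup {M | M ≤ integralCuspForms0 N 2 ∧ (∀ p : ℕ, p.Prime → p ∣ N →
    M.map ((atkinLehnerInvolutionAt N 2 p).restrictScalars ℤ) ≤ M) ∧
    M.map ((halfTranslate N 2).restrictScalars ℤ) ≤ M ∧
    (16 ∣ N → M.map ((ramanujanFour N 2).restrictScalars ℤ) ≤ M) ∧
    (64 ∣ N → M.map ((ramanujanEight N 2).restrictScalars ℤ) ≤ M)}

/-- `S^{G,R} ≤ S^G`. (imc g18b VERBATIM, PROVED.) -/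
theorem endSaturatedConwayLattice_le (N : ℕ) [NeZero N] :
    endSaturatedConwayLattice N ≤ conwayStableLattice N :=
  sSup_le fun _ hM => le_sSup ⟨hM.1, hM.2.1, hM.2.2.1⟩

/-- `S^{G,R} = S^G` at `16 ∤ N` (the two extra stability conditions are vacuous; `S^G` is itself `w_Q`- and `t`-stable by
refuter-1's RB61.1 `conwayStableLattice_map_atkinLehner_le` / `conwayStableLattice_map_halfTranslate_le`, tree
`ConwayRamanujanCutEdges` — used BY NAME instead of the sketch's re-declared copies). (imc g18b, PROVED.) -/
theorem endSaturatedConwayLattice_eq_of_not_sixteen_dvd (N : ℕ) [NeZero N] (h : ¬ 16 ∣ N) :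
    endSaturatedConwayLattice N = conwayStableLattice N := by
  refine le_antisymm (endSaturatedConwayLattice_le N) (le_sSup ?_)
  refine ⟨conwayStableLattice_le, fun p hp hpN => conwayStableLattice_map_atkinLehner_le p hp hpN,
    conwayStableLattice_map_halfTranslate_le, fun h16 => (h h16).elim,
    fun h64 => (h (Nat.dvd_trans ⟨4, by norm_num⟩ h64)).elim⟩

/-- **Candidate E-imc-131 `StarredEndSaturatedDefectLaw` (imc g18; LAW; nothing asserted)** — desc's E-desc-41
`StarredConwayDefectLaw` with the Conway lattice replaced by its End-saturation `S^{G,R}` and the I₀*-exclusion DROPPED: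
every optimal `E` with `4 ∣ N`, starred at `2` (I₀* included) and `E(ℚ)[2] = 0` has End-saturated Conway defect
EXACTLY ONE, `ord₂ [e_f S^{G,R} : ℤ f] + 1 = ord₂ deg φ`.  Census (ENGINE 6 v6, kit j311860, 16 ∣ N ≤ 520): 38/38
(the three torsion-free I₀* zeros 416a1, 464d1, 464f1 of the plain lattice, named in E-desc-41's docstring, all become
`1`); at `16 ∤ N` it is E-desc-41 plus its I₀* rows (desc MS-0).  Pre-registered test: 608c1 (E-desc-41's fourth
named zero).  E-facing content (with `Λ ⊆ S^{G,R}`): `2 ∣ c_E` or the Néron map of `φ` is not Lie-saturated at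
`2`.  Why it might fail: a torsion-free starred curve at `256 ∣ N` (or with a non-automorphic idempotent) whose
missing halving is cut only by a further element of `End_ℚ J₀(N)`; repair = saturate under all of `End`.
VERBATIM HOME/imc/Sketch-imc-g18b.lean 0e966af5982be4b5 `StarredEndSaturatedDefectLaw` (nothing asserted).  REF1 R-imc-50 / REF2:
PENDING at filing.
[cite: CesnaviciusNeururerSaha2023, Thm. 1.2 and p. 4 L10–16 (shape only, as for E-desc-41; the End-saturated exact-defect law is the cell's row E-imc-131, NOT in print — MEMO-imc §24.11–24.13; census ENGINE 6 v6 38/38 + 57/57, pre-registered 608c1)] -/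
@[conjecture]
def StarredEndSaturatedDefectLaw : Prop :=
  ∀ (W : WeierstrassCurve ℚ) [W.IsElliptic] [W.IsGloballyMinimal] [NeZero (W.conductorNorm ℤ)]
    (D : ModularParametrizationData W (W.conductorNorm ℤ)),
    (∀ z ∈ D.L.lattice, ∃ w ∈ periodLattice D.f, z = D.c * w) →
    (∀ (W' : WeierstrassCurve ℚ) [W'.IsElliptic]
        (D' : ModularParametrizationData W' (W.conductorNorm ℤ)),
        D'.f = D.f → D.modularDegree ≤ D'.modularDegree) →
    4 ∣ W.conductorNorm ℤ → IsStarredAtTwo W → ¬ HasRationalTwoTorsion W →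
      padicValNat 2 (lineIndex (endSaturatedConwayLattice (W.conductorNorm ℤ)) D.f) + 1 =
        padicValNat 2 D.modularDegree

/-- E-imc-131 implies desc's E-desc-41 wherever End-saturation does not bite (`16 ∤ N`): the two laws say the same
number there. (PROVED glue.) -/
theorem starredConwayDefect_of_endSaturated_of_not_sixteen_dvd (h : StarredEndSaturatedDefectLaw)
    (W : WeierstrassCurve ℚ) [W.IsElliptic] [W.IsGloballyMinimal] [NeZero (W.conductorNorm ℤ)]
    (D : ModularParametrizationData W (W.conductorNorm ℤ))
    (hL : ∀ z ∈ D.L.lattice, ∃ w ∈ periodLattice D.f, z = D.c * w)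
    (hopt : ∀ (W' : WeierstrassCurve ℚ) [W'.IsElliptic]
        (D' : ModularParametrizationData W' (W.conductorNorm ℤ)),
        D'.f = D.f → D.modularDegree ≤ D'.modularDegree)
    (h4 : 4 ∣ W.conductorNorm ℤ) (h16 : ¬ 16 ∣ W.conductorNorm ℤ) (hs : IsStarredAtTwo W)
    (ht : ¬ HasRationalTwoTorsion W) :
    padicValNat 2 (lineIndex (conwayStableLattice (W.conductorNorm ℤ)) D.f) + 1 = padicValNat 2 D.modularDegree := by
  have := h W D hL hopt h4 hs ht
  rwa [endSaturatedConwayLattice_eq_of_not_sixteen_dvd _ h16] at this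

section Given
variable {N : ℕ} [NeZero N] {W : WeierstrassCurve ℚ} [W.IsElliptic] {D : ModularParametrizationData W N}
  (Δ : NeronFLineDatum W D)

/-- **Candidate E-imc-132 `IsEndSaturatedConwayNeronAtTwo` (imc g18; the R-saturated GIVEN row; THIN)**: the Néron
lattice is `2`-adically the End-saturated Conway lattice.  TRUE at `v₂(N) ≤ 3` with rational singularities
(THEOREM N=C, where `S^{G,R} = S^G`); desc's unsaturated row `IsConwayNeronAtTwo` is FALSE at `N = 240`
(`NeronConway.not_isConwayNeronAtTwo_of_notRamanujanStable`); this row survives every End-test ENGINE 6 has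
(`U₂`, `T₃/U₃`, odd `w_q`, `R₄`, `R₈`) at `16 ∣ N ≤ 520` and is decidable per level by no engine yet.  GIVEN-datum PREDICATE
(typed exactly like desc's `ConwayCut.IsConwayNeronAtTwo`; nothing asserted).  VERBATIM HOME/imc/Sketch-imc-g18b.lean 0e966af5982be4b5.
REF1 R-imc-50: PENDING at filing.
[cite: CesnaviciusNeururerSaha2023, Thm. 1.2 and p. 4 L10–16 (shape only: the Néron lattice as an explicit sublattice; the identification with the End-saturated Conway lattice is the cell's GIVEN row E-imc-132, NOT in print — MEMO-imc §24.13)] -/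
def IsEndSaturatedConwayNeronAtTwo : Prop :=
  Δ.Λ ≤ endSaturatedConwayLattice N ∧ ∀ g ∈ endSaturatedConwayLattice N, ∃ n : ℕ, Odd n ∧ (n : ℤ) • g ∈ Δ.Λ

/-- E-imc-132 in `LeUpToOdd` language (definitional). (imc g18b VERBATIM, PROVED.) -/
theorem isEndSaturatedConwayNeronAtTwo_iff :
    IsEndSaturatedConwayNeronAtTwo Δ ↔
      Δ.Λ ≤ endSaturatedConwayLattice N ∧ LeUpToOdd (endSaturatedConwayLattice N) Δ.Λ := Iff.rfl

end Given

/-- **Candidate E-imc-133 `EndSaturationBitesAt272` (imc g18; DECIDABLE INSTANCE by exact linear algebra, kit j311860: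
`ord₂ [S^G(272) : S^{G,R}(272)] = 1`, kit j312138: same with joint saturation)**: at `N = 272 = 2⁴·17` the Conway
lattice is NOT `2`-adically End-saturated; `S^{G,R}(272)` is a proper sublattice of `S^G(272)` of even index (the optimal
curve 272c1 sees it: `σ₂ = 0`, `σ₂^R = 1`).  VERBATIM HOME/imc/Sketch-imc-g18b.lean 0e966af5982be4b5 (nothing asserted; a kernel certificate
would need `q`-expansions of a `ℤ`-basis of `S₂(Γ₀(272); ℤ)`, not in the tree).  REF1 R-imc-50: PENDING at filing.
[cite: AtkinLehner1970, §4 (shape only: normaliser of `Γ₀(N)` and the operators it induces; the index statement at `N = 272` is the cell's decidable row E-imc-133, two engines (kit j311860, j312138), NOT in print — MEMO-imc §24.12)] -/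
@[conjecture]
def EndSaturationBitesAt272 : Prop :=
  ¬ LeUpToOdd (conwayStableLattice 272) (endSaturatedConwayLattice 272)

/-! ### Typer edges (PROVED): the FACT `Λ ⊆ S^{G,R}` from the stability hypotheses, the two GIVEN rows compared, and
E-imc-133 + E-imc-132 ⟹ ¬ E-desc-28♯ at `N = 272` -/

section TyperEdges

variable {N : ℕ} [NeZero N] {W : WeierstrassCurve ℚ} [W.IsElliptic] {D : ModularParametrizationData W N}
  (Δ : NeronFLineDatum W D)

/-- `Λ ≤ S^{G,R}` — the R-saturated sharpening of `ConwayCut.Λ_le_conwayStableLattice`, from `t`-, `R₄`- (at `16 ∣ N`) and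
`R₈`- (at `64 ∣ N`) stability of the Néron lattice (Néron mapping property for these elements of `Aut` / `End_ℚ J₀(N)`,
passed as hypotheses exactly like `ht` there; imc's «FACT, one line»). (typer edge, PROVED.) -/
theorem Λ_le_endSaturatedConwayLattice (ht : Δ.Λ.map ((halfTranslate N 2).restrictScalars ℤ) ≤ Δ.Λ)
    (hR4 : 16 ∣ N → Δ.Λ.map ((ramanujanFour N 2).restrictScalars ℤ) ≤ Δ.Λ)
    (hR8 : 64 ∣ N → Δ.Λ.map ((ramanujanEight N 2).restrictScalars ℤ) ≤ Δ.Λ) :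
    Δ.Λ ≤ endSaturatedConwayLattice N :=
  le_sSup ⟨Δ.Λ_le, Δ.map_atkinLehner_le, ht, hR4, hR8⟩

/-- At `16 ∤ N` the R-saturated GIVEN row E-imc-132 IS desc's GIVEN row E-desc-28♯ (`S^{G,R} = S^G` there). (typer edge, PROVED.) -/
theorem isEndSaturatedConwayNeronAtTwo_iff_isConwayNeronAtTwo (h : ¬ 16 ∣ N) :
    IsEndSaturatedConwayNeronAtTwo Δ ↔ IsConwayNeronAtTwo Δ := by
  rw [IsEndSaturatedConwayNeronAtTwo, IsConwayNeronAtTwo, endSaturatedConwayLattice_eq_of_not_sixteen_dvd N h]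

/-- E-imc-132 always gives the first clause of E-desc-28♯ (`Λ ≤ S^G`) and the `2`-adic containment `S^{G,R} ⊆ Λ`; the
missing piece for E-desc-28♯ is exactly `LeUpToOdd S^G S^{G,R}` — which E-imc-133 DENIES at `N = 272`. (typer edge, PROVED.) -/
theorem isConwayNeronAtTwo_of_isEndSaturated (hΛ : IsEndSaturatedConwayNeronAtTwo Δ)
    (hsat : LeUpToOdd (conwayStableLattice N) (endSaturatedConwayLattice N)) : IsConwayNeronAtTwo Δ :=
  ⟨hΛ.1.trans (endSaturatedConwayLattice_le N), leUpToOdd_trans hsat hΛ.2⟩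

/-- Conversely E-desc-28♯ plus `Λ ≤ S^{G,R}` forces `LeUpToOdd S^G S^{G,R}`. (typer edge, PROVED.) -/
theorem leUpToOdd_conway_endSaturated_of_isConwayNeronAtTwo (hΛ : IsConwayNeronAtTwo Δ)
    (hle : Δ.Λ ≤ endSaturatedConwayLattice N) :
    LeUpToOdd (conwayStableLattice N) (endSaturatedConwayLattice N) :=
  (leUpToOdd_trans hΛ.2 (leUpToOdd_of_le hle))

end TyperEdges

/-- **E-imc-133 ∧ (`Λ ≤ S^{G,R}` at `N = 272`) ⟹ ¬ E-desc-28♯ at `N = 272`**: a second located failure of desc's unsaturated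
GIVEN row `IsConwayNeronAtTwo` (after `N = 240`, `NeronConway.not_isConwayNeronAtTwo_of_notRamanujanStable`), this time through
the JOINT saturation; the containment `Λ ≤ S^{G,R}` is `Λ_le_endSaturatedConwayLattice` fed with the Néron-mapping-property
hypotheses, or the first clause of E-imc-132. (typer edge, PROVED; nothing asserted about E-imc-133 itself.) -/
theorem not_isConwayNeronAtTwo_of_endSaturationBites (h133 : EndSaturationBitesAt272)
    {W : WeierstrassCurve ℚ} [W.IsElliptic] {D : ModularParametrizationData W 272} (Δ : NeronFLineDatum W D)
    (hle : Δ.Λ ≤ endSaturatedConwayLattice 272) : ¬ IsConwayNeronAtTwo Δ :=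
  fun hΛ => h133 (leUpToOdd_conway_endSaturated_of_isConwayNeronAtTwo Δ hΛ hle)

end Summit.BirchSwinnertonDyer.Rank1Residual.ManinAdditive.NeronConwayR

end
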